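import Summits.AtomisticToContinuum.HydrodynamicLimit.Theorems.JaynesSqueezeLocalGibbsConcentrationDiluteTilt
import Summits.AtomisticToContinuum.HydrodynamicLimit.Theorems.JaynesSqueezeLocalGibbsConcentrationDiluteTiltedDensity
import Literature.Analysis.FluidPDE.HardSphereAlexander

/-!
# Exponential concentration of the density field of dilute local Gibbs states, from the static LDA

Helper file for item `LocalGibbsConcentrationDilute` (stmt-AtomisticToContinuum-13460) of route
`JaynesSqueeze`: the POSITION part. Assuming the route's static local-density package
`HardSphereLDA` (item stmt-AtomisticToContinuum-13459; only clause (B): the mean empirical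
density of the canonical hard-sphere gas with activity `ρ e^{g_σ(ρ)}` tends to `ρ`) and
`HsEosLowDensity`, the empirical density field `(N+1)⁻¹ ∑ f(xᵢ)` of the configurational Gibbs
measure with activity `a₁ = ρ₁ e^{g_σ(ρ₁)}` deviates from `∫ f ρ₁` by more than `δ` with
probability `≤ C e^{-(N+1)/C}` (`posGibbsMeasure_density_concentration_of_meanLDA`, from the
mean-density law of large numbers for continuous profiles, which `meanLDA_of_hardSphereLDA`
extracts from `HardSphereLDA` (B)).

Mechanism: the tilt bound of `JaynesSqueezeLocalGibbsConcentrationDiluteTilt` reduces the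
exponential estimate to the law of large numbers for the MEAN density under the tilted
activities `a₁ e^{±tf}`; by `exists_tilted_density` these are, up to constants, the activities
`ρ_± e^{g_σ(ρ_±)}` of normalised densities `ρ_±` uniformly close to `ρ₁`, to which (B) applies
(through any family of hard-sphere flows, which exist by Alexander's theorem; the canonical law
is invariant under constant multiples of the activity, `posGibbsMeasure_const_mul`).

Also: `exists_continuousOn_excessChemicalPotential` (continuity of
`η ↦ f_ex(η) + η f_ex'(η)` near `0` under `HsEosLowDensity`) and the bridge
`integral_empiricalDensityField_localGibbsLaw` from the local Gibbs law to its position marginal.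

No definitions (pure-proof helper file). prover-pitem-stmt-AtomisticToContinuum-13460-0.
-/

noncomputable section

namespace Summit.AtomisticToContinuum.HydrodynamicLimit.Theorems

open MeasureTheory Filter Topology Set
open Literature.Analysis.FluidPDE Literature.MathematicalPhysics.KineticTheory
open Summit.AtomisticToContinuum.HydrodynamicLimit.Theses.JaynesSqueeze
open scoped ENNReal

namespace LocalGibbsConcentration

section Eos

/-- **Continuity of the excess chemical potential at low density.** Under `HsEosLowDensity`,
`η ↦ f_ex(η) + η f_ex'(η)` (`f_ex = hsExcessFreeEnergy`) is continuous on `[0, η₄]` for some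
`η₄ > 0` (it is `F + id · F'` for the real-analytic `F`). [folklore] -/
theorem exists_continuousOn_excessChemicalPotential (hEos : HsEosLowDensity) :
    ∃ η₄ : ℝ, 0 < η₄ ∧ ContinuousOn (fun η => hsExcessFreeEnergy η +
      η * deriv hsExcessFreeEnergy η) (Icc 0 η₄) := by
  obtain ⟨η₀, hη₀, F, hF, hEq, -, -, -⟩ := hEos
  have hUo : IsOpen (Ioo (-η₀) η₀) := isOpen_Ioo
  have hGF : ContinuousOn (fun η => F η + η * deriv F η) (Ioo (-η₀) η₀) :=
    hF.continuousOn.add (continuousOn_id.mul hF.deriv.continuousOn)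
  refine ⟨η₀ / 2, by positivity, (hGF.mono fun η hη => ⟨by linarith [hη.1], by linarith [hη.2]⟩).congr
    fun η hη => ?_⟩
  rcases hη.1.eq_or_lt with h | h
  · simp only [← h, zero_mul, add_zero]
    exact hEq ⟨le_rfl, hη₀⟩
  · have hηlt : η < η₀ := by linarith [hη.2]
    have hev : hsExcessFreeEnergy =ᶠ[𝓝 η] F := by
      filter_upwards [isOpen_Ioo.mem_nhds ⟨h, hηlt⟩] with y hy using hEq ⟨hy.1.le, hy.2⟩
    simp only
    rw [hEq ⟨hη.1, hηlt⟩, hev.deriv_eq]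

end Eos

section Marginal

variable {a θ₀ : T3 → ℝ} {u₀ : T3 → V3}

/-- **The canonical law is invariant under constant multiples of the activity**:
`posGibbsMeasure (κ a) = posGibbsMeasure a` for `κ ≠ 0` (the weight scales by `κⁿ`, and so does
the partition function). [folklore] -/
theorem posGibbsMeasure_const_mul {κ : ℝ} (hκ : κ ≠ 0) (ε : ℝ) (n : ℕ) :
    posGibbsMeasure (fun y => κ * a y) ε n = posGibbsMeasure a ε n := by
  have hw : ∀ x : Fin n → T3, posWeight (fun y => κ * a y) ε n x = κ ^ n * posWeight a ε n x := by
    intro x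
    unfold posWeight
    by_cases hx : x ∈ posDomain ε n
    · rw [indicator_of_mem hx, indicator_of_mem hx, Finset.prod_mul_distrib, Finset.prod_const,
        Finset.card_univ, Fintype.card_fin]
    · rw [indicator_of_notMem hx, indicator_of_notMem hx, mul_zero]
  have hZ : posPartition (fun y => κ * a y) ε n = κ ^ n * posPartition a ε n := by
    rw [posPartition, posPartition, ← integral_const_mul]
    exact integral_congr_ae (Eventually.of_forall hw)
  have hκn : κ ^ n ≠ 0 := pow_ne_zero n hκ
  rw [posGibbsMeasure, posGibbsMeasure]
  congr 1
  funext x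
  rw [hZ, hw x, mul_inv]
  congr 1
  field_simp

/-- The position marginal of the local Gibbs measure, as a push-forward identity. [folklore] -/
theorem map_pos_localGibbsMeasure (ha : Continuous a) (hθ : Continuous θ₀) (hu : Continuous u₀)
    (ha0 : ∀ x, 0 ≤ a x) (hθ0 : ∀ x, 0 < θ₀ x) (σ : ℝ) (N : ℕ) :
    (localGibbsMeasure σ a u₀ θ₀ N).map (fun z i => (z i).1) =
      posGibbsMeasure a (hsDiameter σ N) (N + 1) := by
  have hposm : Measurable (fun z : Config (N + 1) (Fin 3) T3 => fun i => (z i).1) :=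
    measurable_pi_lambda _ fun i => (measurable_pi_apply i).fst
  refine Measure.ext fun S hS => ?_
  rw [Measure.map_apply hposm hS, localGibbsMeasure_preimage_pos ha hθ hu ha0 hθ0 σ N hS]

/-- **Mean density field through the position marginal**:
`∫ (empirical density field of f) d(localGibbsLaw) = (N+1)⁻¹ ∫ ∑ f(xᵢ) d(posGibbsMeasure)`.
[folklore] -/
theorem integral_empiricalDensityField_localGibbsLaw (ha : Continuous a) (hθ : Continuous θ₀)
    (hu : Continuous u₀) (ha0 : ∀ x, 0 ≤ a x) (hθ0 : ∀ x, 0 < θ₀ x) (σ : ℝ) (N : ℕ)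
    (Φ : HardSphereFlow (Torus.geometry (Fin 3)) (hsDiameter σ N) (N + 1))
    {f : T3 → ℝ} (hf : Continuous f) :
    ∫ z, empiricalDensityField z f ∂localGibbsLaw σ a u₀ θ₀ N Φ =
      ((N + 1 : ℕ) : ℝ)⁻¹ * ∫ x, ∑ i, f (x i) ∂posGibbsMeasure a (hsDiameter σ N) (N + 1) := by
  have hposm : Measurable (fun z : Config (N + 1) (Fin 3) T3 => fun i => (z i).1) :=
    measurable_pi_lambda _ fun i => (measurable_pi_apply i).fst
  rw [localGibbsLaw_eq]
  simp_rw [empiricalDensityField_eq_sum]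
  rw [integral_const_mul, ← map_pos_localGibbsMeasure ha hθ hu ha0 hθ0 σ N,
    integral_map hposm.aemeasurable (measurable_sum hf (N + 1)).aestronglyMeasurable]

end Marginal

section Density

/-- **Hard-sphere flows exist at every level** for `0 < σ ≤ 1/2`... precisely for `0 < σ` with
`σ < 1/2` (Alexander's theorem on the torus, `HardSphereFlow.nonempty_torus_holds`; the diameter
`σ (N+1)^{-1/3} ≤ σ < 1/2`). [folklore] -/
theorem nonempty_flow {σ : ℝ} (hσ : 0 < σ) (hσ2 : σ < 1 / 2) (N : ℕ) :
    Nonempty (HardSphereFlow (Torus.geometry (Fin 3)) (hsDiameter σ N) (N + 1)) :=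
  HardSphereFlow.nonempty_torus_holds (hsDiameter_pos hσ N)
    (lt_of_le_of_lt (hsDiameter_le hσ.le N) (by rw [inv_eq_one_div]; exact hσ2)) (N + 1)

/-- A continuous probability density on `𝕋³` takes a value `≥ 1`. [folklore] -/
theorem exists_one_le_of_integral_eq_one {ρ : T3 → ℝ} (hρ : Continuous ρ) (h1 : ∫ x, ρ x = 1) :
    ∃ x, 1 ≤ ρ x := by
  by_contra h
  push Not at h
  obtain ⟨x₀, -, hx₀⟩ := isCompact_univ.exists_isMaxOn univ_nonempty hρ.continuousOn
  have hle : ∀ x, ρ x ≤ ρ x₀ := fun x => hx₀ (mem_univ x)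
  have : ∫ x, ρ x ≤ ∫ _x : T3, ρ x₀ :=
    integral_mono (integrable_of_continuous_T3 hρ) (integrable_const _) hle
  rw [h1, integral_const, smul_eq_mul, probReal_univ, one_mul] at this
  linarith [h x₀]

/-- `σ < 1/2` once a normalised density `ρ₁` has packing `ρ₁ σ³ ≤ 1/16`. [folklore] -/
theorem sigma_lt_half {σ : ℝ} (hσ : 0 < σ) {ρ₁ : T3 → ℝ} (hρ : Continuous ρ₁) (h1 : ∫ x, ρ₁ x = 1)
    (hband : ∀ x, ρ₁ x * σ ^ 3 ≤ 1 / 16) : σ < 1 / 2 := by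
  obtain ⟨x, hx⟩ := exists_one_le_of_integral_eq_one hρ h1
  have h3 : σ ^ 3 ≤ 1 / 16 :=
    calc σ ^ 3 = 1 * σ ^ 3 := (one_mul _).symm
      _ ≤ ρ₁ x * σ ^ 3 := mul_le_mul_of_nonneg_right hx (pow_pos hσ 3).le
      _ ≤ 1 / 16 := hband x
  by_contra h
  push Not at h
  have : (1 / 2 : ℝ) ^ 3 ≤ σ ^ 3 := pow_le_pow_left₀ (by norm_num) h 3
  linarith [this]

/-- **Exponential concentration of the density field, from the mean-density LDA.** Assume
`HsEosLowDensity` and the law of large numbers for the MEAN density of the configurational Gibbs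
measure with activity `ρ e^{g_σ(ρ)}` (continuous normalised `ρ` in the band `c ≤ ρ`,
`ρσ³ ≤ η₁'`): its mean empirical density field of `f` tends to `∫ f ρ`. Then there is
`η₁ ∈ (0, min(1/16, η₁')]` such that for all `σ > 0`, `c > 0`, every continuous normalised `ρ₁`
with `c ≤ ρ₁`, `ρ₁σ³ ≤ η₁`: the activity `a₁ = ρ₁ e^{g_σ(ρ₁)}` is continuous, and for every
continuous `f` and `δ > 0` there is `C > 0` with
`posGibbsMeasure a₁ {δ < |(N+1)⁻¹ ∑ f(xᵢ) - ∫ f ρ₁|} ≤ C e^{-(N+1)/C}` for all `N` (tilt bound +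
mean densities under the tilted activities, identified through the inversion
`exists_tilted_density`). [folklore] -/
theorem posGibbsMeasure_density_concentration_of_meanLDA (hEos : HsEosLowDensity) {η₁' : ℝ}
    (hη₁' : 0 < η₁')
    (hM : ∀ σ : ℝ, 0 < σ → ∀ c : ℝ, 0 < c → ∀ ρ : T3 → ℝ, Continuous ρ →
      (∀ x, c ≤ ρ x ∧ ρ x * σ ^ 3 ≤ η₁') → ∫ x, ρ x = 1 → ∀ f : T3 → ℝ, Continuous f →
      Tendsto (fun N : ℕ => ((N + 1 : ℕ) : ℝ)⁻¹ * ∫ x, ∑ i, f (x i)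
        ∂posGibbsMeasure (fun x => ρ x * Real.exp (hsExcessFreeEnergy (ρ x * σ ^ 3) +
          ρ x * σ ^ 3 * deriv hsExcessFreeEnergy (ρ x * σ ^ 3))) (hsDiameter σ N) (N + 1))
        atTop (𝓝 (∫ x, f x * ρ x))) :
    ∃ η₁ : ℝ, 0 < η₁ ∧ η₁ ≤ 1 / 16 ∧ ∀ σ : ℝ, 0 < σ → ∀ c : ℝ, 0 < c → ∀ ρ₁ : T3 → ℝ,
      Continuous ρ₁ → (∀ x, c ≤ ρ₁ x ∧ ρ₁ x * σ ^ 3 ≤ η₁) → ∫ x, ρ₁ x = 1 →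
      Continuous (fun x => ρ₁ x * Real.exp (hsExcessFreeEnergy (ρ₁ x * σ ^ 3) +
        ρ₁ x * σ ^ 3 * deriv hsExcessFreeEnergy (ρ₁ x * σ ^ 3))) ∧
      ∀ f : T3 → ℝ, Continuous f → ∀ δ : ℝ, 0 < δ → ∃ C : ℝ, 0 < C ∧ ∀ N : ℕ,
        posGibbsMeasure (fun x => ρ₁ x * Real.exp (hsExcessFreeEnergy (ρ₁ x * σ ^ 3) +
          ρ₁ x * σ ^ 3 * deriv hsExcessFreeEnergy (ρ₁ x * σ ^ 3))) (hsDiameter σ N) (N + 1)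
          {x | δ < |((N + 1 : ℕ) : ℝ)⁻¹ * ∑ i, f (x i) - ∫ y, f y * ρ₁ y|} ≤
        ENNReal.ofReal (C * Real.exp (-(C⁻¹ * (N + 1)))) := by
  obtain ⟨η₂, hη₂, hT⟩ := exists_tilted_density hEos
  obtain ⟨η₄, hη₄, hGcont⟩ := exists_continuousOn_excessChemicalPotential hEos
  set η₁ : ℝ := min (min (η₁' / 2) η₂) (min (η₄ / 2) (1 / 16)) with hη₁
  have hη₁pos : 0 < η₁ := lt_min (lt_min (by positivity) hη₂) (lt_min (by positivity) (by norm_num))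
  have hη₁L2 : η₁ ≤ η₁' / 2 := (min_le_left _ _).trans (min_le_left _ _)
  have hη₁2 : η₁ ≤ η₂ := (min_le_left _ _).trans (min_le_right _ _)
  have hη₁4 : η₁ ≤ η₄ / 2 := (min_le_right _ _).trans (min_le_left _ _)
  have hη₁8 : η₁ ≤ 1 / 16 := (min_le_right _ _).trans (min_le_right _ _)
  refine ⟨η₁, hη₁pos, hη₁8, fun σ hσ c hc ρ₁ hρ₁c hband hnorm => ?_⟩
  -- abbreviations (as local definitions)
  set G : ℝ → ℝ := fun η => hsExcessFreeEnergy η + η * deriv hsExcessFreeEnergy η with hG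
  set a₁ : T3 → ℝ := fun x => ρ₁ x * Real.exp (G (ρ₁ x * σ ^ 3)) with ha₁
  have hσ3 : 0 < σ ^ 3 := by positivity
  have hρ₁pos : ∀ x, 0 < ρ₁ x := fun x => hc.trans_le (hband x).1
  have hρ₁nn : ∀ x, 0 ≤ ρ₁ x := fun x => (hρ₁pos x).le
  have hρσmem : ∀ x, ρ₁ x * σ ^ 3 ∈ Icc 0 η₄ := fun x =>
    ⟨mul_nonneg (hρ₁nn x) hσ3.le, (hband x).2.trans (by linarith)⟩
  have ha₁c : Continuous a₁ :=
    hρ₁c.mul (Real.continuous_exp.comp (hGcont.comp_continuous (hρ₁c.mul continuous_const) hρσmem))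
  have ha₁pos : ∀ x, 0 < a₁ x := fun x => mul_pos (hρ₁pos x) (Real.exp_pos _)
  have hσlt : σ < 1 / 2 := sigma_lt_half hσ hρ₁c hnorm fun x => (hband x).2.trans hη₁8
  have hσhalf : σ ≤ 1 / 2 := hσlt.le
  refine ⟨ha₁c, fun f hf δ hδ => ?_⟩
  obtain ⟨K, hK0, hK⟩ := exists_forall_abs_le_of_continuous hf
  -- the inversion under tilts, with accuracy `ε`
  set ε : ℝ := min (c / 2) (min (η₁' / (2 * σ ^ 3)) (δ / (4 * (K + 1)))) with hε
  have hεpos : 0 < ε := lt_min (by positivity) (lt_min (by positivity) (by positivity))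
  have hεc : ε ≤ c / 2 := min_le_left _ _
  have hεL : ε ≤ η₁' / (2 * σ ^ 3) := (min_le_right _ _).trans (min_le_left _ _)
  have hεδ : ε ≤ δ / (4 * (K + 1)) := (min_le_right _ _).trans (min_le_right _ _)
  obtain ⟨t₀, ht₀, hTt⟩ := hT σ hσ ρ₁ hρ₁c hρ₁nn (fun x => (hband x).2.trans hη₁2) hnorm f hf ε hεpos
  -- the common step: a tilted density gives the eventual bound on the tilted mean density
  have key : ∀ t : ℝ, |t| ≤ t₀ → ∀ᶠ N : ℕ in atTop,
      |((N + 1 : ℕ) : ℝ)⁻¹ * (∫ x, ∑ i, f (x i)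
        ∂posGibbsMeasure (fun y => a₁ y * Real.exp (t * f y)) (hsDiameter σ N) (N + 1)) -
        ∫ y, f y * ρ₁ y| < δ / 2 := by
    intro t ht
    obtain ⟨κ, ρ, hκ, hρc, -, hρclose, hρnorm, hρid⟩ := hTt t ht
    -- `ρ` is in the band of the mean-density hypothesis
    have hρband : ∀ x, c / 2 ≤ ρ x ∧ ρ x * σ ^ 3 ≤ η₁' := by
      intro x
      have h1 := abs_le.1 (hρclose x)
      refine ⟨by linarith [(hband x).1], ?_⟩
      have h2 : ρ x ≤ ρ₁ x + ε := by linarith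
      calc ρ x * σ ^ 3 ≤ (ρ₁ x + ε) * σ ^ 3 := mul_le_mul_of_nonneg_right h2 hσ3.le
        _ = ρ₁ x * σ ^ 3 + ε * σ ^ 3 := by ring
        _ ≤ η₁' / 2 + η₁' / 2 := by
            refine add_le_add ((hband x).2.trans hη₁L2) ?_
            rw [le_div_iff₀ (by positivity)] at hεL
            linarith
        _ = η₁' := by ring
    -- the activity of `ρ` is `κ` times the tilted activity
    have hact : (fun x => ρ x * Real.exp (hsExcessFreeEnergy (ρ x * σ ^ 3) +
        ρ x * σ ^ 3 * deriv hsExcessFreeEnergy (ρ x * σ ^ 3))) =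
        fun x => κ * (a₁ x * Real.exp (t * f x)) := by
      funext x
      rw [hρid x]
      simp only [ha₁, hG]
      ring
    -- the mean-density hypothesis for `ρ`, rewritten for the tilted activity
    have h := hM σ hσ (c / 2) (by positivity) ρ hρc hρband hρnorm f hf
    rw [hact] at h
    simp_rw [posGibbsMeasure_const_mul hκ.ne'] at h
    -- the limit is within `δ/4` of `∫ f ρ₁`
    have hlim : |(∫ y, f y * ρ y) - ∫ y, f y * ρ₁ y| ≤ δ / 4 := by
      have i1 : Integrable (fun y => f y * ρ y) := integrable_of_continuous_T3 (hf.mul hρc)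
      have i2 : Integrable (fun y => f y * ρ₁ y) := integrable_of_continuous_T3 (hf.mul hρ₁c)
      have hsub : (∫ y, f y * ρ y) - ∫ y, f y * ρ₁ y = ∫ y, (f y * ρ y - f y * ρ₁ y) :=
        (integral_sub i1 i2).symm
      rw [hsub]
      calc |∫ y, (f y * ρ y - f y * ρ₁ y)| ≤ ∫ y, |f y * ρ y - f y * ρ₁ y| :=
            abs_integral_le_integral_abs
        _ ≤ ∫ _y : T3, K * ε := by
            refine integral_mono (integrable_of_continuous_T3 (by fun_prop)) (integrable_const _)
              fun y => ?_
            show |f y * ρ y - f y * ρ₁ y| ≤ K * ε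
            rw [← mul_sub, abs_mul]
            exact mul_le_mul (hK y) (hρclose y) (abs_nonneg _) hK0
        _ = K * ε := by simp
        _ ≤ K * (δ / (4 * (K + 1))) := mul_le_mul_of_nonneg_left hεδ hK0
        _ ≤ δ / 4 := by
            rw [mul_div_assoc', div_le_div_iff₀ (by positivity) (by positivity)]
            nlinarith
    have hev := (Metric.tendsto_nhds.1 h) (δ / 4) (by positivity)
    filter_upwards [hev] with N hN
    rw [Real.dist_eq] at hN
    calc _ ≤ |((N + 1 : ℕ) : ℝ)⁻¹ * (∫ x, ∑ i, f (x i)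
          ∂posGibbsMeasure (fun y => a₁ y * Real.exp (t * f y)) (hsDiameter σ N) (N + 1)) -
          ∫ y, f y * ρ y| + |(∫ y, f y * ρ y) - ∫ y, f y * ρ₁ y| := abs_sub_le _ _ _
      _ < δ / 4 + δ / 4 := add_lt_add_of_lt_of_le hN hlim
      _ = δ / 2 := by ring
  -- the two tilts `±t₀`
  have hplus := key t₀ (le_of_eq (abs_of_pos ht₀))
  have hminus := key (-t₀) (by rw [abs_neg, abs_of_pos ht₀])
  obtain ⟨N₀, hN₀⟩ := eventually_atTop.1 (hplus.and hminus)
  exact posGibbsMeasure_density_concentration ha₁c ha₁pos hf hσhalf (I := ∫ y, f y * ρ₁ y) hδ ht₀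
    (N₀ := N₀)
    (fun N hN => by
      have h := (abs_lt.1 (hN₀ N hN).1).2
      linarith)
    (fun N hN => by
      have h := (abs_lt.1 (hN₀ N hN).2).1
      linarith)

/-- **The mean-density LDA from the route's `HardSphereLDA`** (clause (B), for continuous profiles,
stated on the configurational Gibbs measure): the flow family needed to instantiate (B) exists by
Alexander's theorem (`nonempty_flow`), and the mean empirical density of the local Gibbs law is
that of its position marginal (`integral_empiricalDensityField_localGibbsLaw`). [folklore] -/
theorem meanLDA_of_hardSphereLDA (hEos : HsEosLowDensity) (hLDA : HardSphereLDA) :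
    ∃ η₁' : ℝ, 0 < η₁' ∧ ∀ σ : ℝ, 0 < σ → ∀ c : ℝ, 0 < c → ∀ ρ : T3 → ℝ, Continuous ρ →
      (∀ x, c ≤ ρ x ∧ ρ x * σ ^ 3 ≤ η₁') → ∫ x, ρ x = 1 → ∀ f : T3 → ℝ, Continuous f →
      Tendsto (fun N : ℕ => ((N + 1 : ℕ) : ℝ)⁻¹ * ∫ x, ∑ i, f (x i)
        ∂posGibbsMeasure (fun x => ρ x * Real.exp (hsExcessFreeEnergy (ρ x * σ ^ 3) +
          ρ x * σ ^ 3 * deriv hsExcessFreeEnergy (ρ x * σ ^ 3))) (hsDiameter σ N) (N + 1))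
        atTop (𝓝 (∫ x, f x * ρ x)) := by
  obtain ⟨η₁L, hη₁L, hL⟩ := hLDA hEos
  obtain ⟨η₄, hη₄, hGcont⟩ := exists_continuousOn_excessChemicalPotential hEos
  refine ⟨min η₁L (min (η₄ / 2) (1 / 16)), lt_min hη₁L (lt_min (by positivity) (by norm_num)),
    fun σ hσ c hc ρ hρc hband hnorm f hf => ?_⟩
  have hbL : ∀ x, c ≤ ρ x ∧ ρ x * σ ^ 3 ≤ η₁L := fun x =>
    ⟨(hband x).1, (hband x).2.trans (min_le_left _ _)⟩
  have hσ3 : 0 < σ ^ 3 := by positivity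
  have hρpos : ∀ x, 0 < ρ x := fun x => hc.trans_le (hband x).1
  have hσlt : σ < 1 / 2 := sigma_lt_half hσ hρc hnorm fun x =>
    (hband x).2.trans ((min_le_right _ _).trans (min_le_right _ _))
  have hρσmem : ∀ x, ρ x * σ ^ 3 ∈ Icc 0 η₄ := fun x =>
    ⟨mul_nonneg (hρpos x).le hσ3.le, (hband x).2.trans (((min_le_right _ _).trans
      (min_le_left _ _)).trans (by linarith))⟩
  have hac : Continuous fun x => ρ x * Real.exp (hsExcessFreeEnergy (ρ x * σ ^ 3) +
      ρ x * σ ^ 3 * deriv hsExcessFreeEnergy (ρ x * σ ^ 3)) :=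
    hρc.mul (Real.continuous_exp.comp (hGcont.comp_continuous (hρc.mul continuous_const) hρσmem))
  have ha0 : ∀ x, 0 ≤ ρ x * Real.exp (hsExcessFreeEnergy (ρ x * σ ^ 3) +
      ρ x * σ ^ 3 * deriv hsExcessFreeEnergy (ρ x * σ ^ 3)) := fun x =>
    (mul_pos (hρpos x) (Real.exp_pos _)).le
  -- a family of hard-sphere flows (only to instantiate (B); the laws do not depend on it)
  have Φ : (N : ℕ) → HardSphereFlow (Torus.geometry (Fin 3)) (hsDiameter σ N) (N + 1) :=
    fun N => (nonempty_flow hσ hσlt N).some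
  obtain ⟨-, hB⟩ := hL σ hσ
  have h := (hB c hc ρ hρc.measurable hbL hnorm (fun _ => (0 : V3)) (fun _ => (1 : ℝ))
    measurable_const measurable_const (fun _ => one_pos) Φ).2.2 f hf
  refine h.congr fun N => ?_
  dsimp only
  exact integral_empiricalDensityField_localGibbsLaw (u₀ := fun _ => (0 : V3))
    (θ₀ := fun _ => (1 : ℝ)) hac continuous_const continuous_const ha0 (fun _ => one_pos) σ N (Φ N) hf

end Density

end LocalGibbsConcentration

end Summit.AtomisticToContinuum.HydrodynamicLimit.Theorems
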